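import Summits.QuantumFields.BalabanUV.Beta.D1BFx.StraightPinRestRow

/-!
# `BalabanUV.Beta.D1BFx.DiagBracketWordMass` — road «BF-x», binder row D1, PART 24-hyb HEAD rows (mcol) ∕ (ms) ∕ (lamf) in MASS currency (leaf-03 g33, TT27a; the generic half of
# the (mcol) row file `ChartDefectRowMcolMass`): **THE BRACKET WORD `[D_p, V_q]` OF A DIAGONAL KERNEL AGAINST A KERNEL OF WEIGHTED MASS — `ℓ¹` BOOKKEEPING AND `Decay510`.**
Read the DIAGONAL factor in SUP (its symbol decays from its coarse point `p`) and the other factor in σ-WEIGHTED `ℓ¹` MASS around ITS coarse point `q`: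
`mass([diagK g, V]) ≤ 2·Gc·e^{−δ|p − q|₁}·M_σ(V)` as soon as `δ ≤ σ` (§1 `wmass_bracket_le`: `e^{−δ|x − p|} ≤ e^{−δ|p − q|}·e^{δ|x − q|}`, the weight absorbs the second factor);
no lattice volume `Zl` is paid at the trace (d1-leaf-04's `GhostWordFamilies.decay510_tadpoleWord_of_mass`: `|tadpole L W| ≤ S·mass W` for a bounded leg), and the decay between the two
coarse points `n•0`, `n•z` is `e^{−(n·δ)|z|₁}` — an `n`-FREE rate when `δ ≍ 1∕n` (§2 `decay510_bracketWord_of_wmass`).  This is the currency the OWNER d1-p2 g25's N-g25-1 (l.54036)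
names for the HEAD's rows; gan24-leaf-05 g62's K0-REST-ROW `StraightPinRestRow` (its `fibreMass_eq_sum_blk` is consumed BY NAME in `wmass_le_of_blk`) and leaf-01 g33's O-9∕O-10 are its
sister files for the rows (rest) ∕ (dd).
CONTENT.  §1 (generic `d`): `abs_bracket_entry_le`, **`wmass_bracket_le`**, `mass_add_le`; (`d = 3`) `wmass_le_of_blk`.  §2 (generic `d`): **`decay510_bracketWord_of_wmass`** — leg `Bdd L S`,
two enveloped diagonal symbol families, two kernel families of σ-weighted mass `≤ MV` at their coarse points, `δ ≤ σ` ⟹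
`Decay510 (z ↦ c·tadpole L ([diagK (gE z), VA 0] + [diagK (gA 0), VE z])) (|c|·(S·(2·Gc·MV + 2·Gc·MV))) (n·δ)`.
[folklore] bookkeeping BY NAME; no definition, no `def … : Prop`, nothing cited, 0 sorry; prices NO (1.22) row by itself (the record rows are the sibling files').

HONEST DEPENDENCY (cell records, verbatim): «continuum YM on T⁴ ⇐ BetaPertH ∧ nine spine estimates (0/9 proved); BetaPertH ⇐ (D1) ∧ (D4) ∧
CAP+tail; G-an2-4 gates asym, D1 and NE2/3/4.»  HONEST FRAMING (cell contract, verbatim): «discharging `BetaPertH` makes Bałaban's UV stability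
UNCONDITIONAL — a real constructive-QFT result; it is NOT the continuum limit and NOT the Clay problem.»  0∕4 row-D1 binders (hW ∕ hR ∕ D1Tel ∕ D1Rep); (J1) ONE OPEN ROW; (K) NOT
closed; NOT D1, NEVER «G-an2-4 closed», NOT `BetaPertH`, NOT continuum, NOT Clay.

ABSOLUTE RULE (cell charter, verbatim): «No internally-minted statement may enter as a cited fact. Every hypothesis is either kernel-proved in
this package or a verbatim quotation of a PUBLISHED theorem with page reference. The manuscript(s) under audit are NOT citable for their own
disputed steps — they are the thing under adjudication; programme-internal (2001/route/tribunal) claims are never citable.»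

Unit `b2b-balaban-beta-d1-formalise-leaf-03` (gen 33), D1 formalisation swarm LEAF PROVER 03, road «BF-x»; 2026-08-23.  No existing file touched.
-/

noncomputable section

namespace Summit.QuantumFields.BalabanUV.Beta.D1BFx.DiagBracketWordMass

open Finset
open scoped BigOperators
open Literature.MathematicalPhysics.QuantumFieldTheory
open Literature.MathematicalPhysics.QuantumFieldTheory.Balaban1983to89
open Literature.MathematicalPhysics.QuantumFieldTheory.Balaban1983to89.Beta
open B12Sec2to5 (l1 l1_nonneg Decay510)
open ExpKernelCalculus (Site MKer comp tadpole l1_sub_triangle l1_sub_symm l1_natSmul)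
open KernelWard (Bdd)
open OneStepResolventKernel (Fib)
open Summit.QuantumFields.BalabanUV.Beta.BorderedHessian (diagK comp_diagK_left comp_diagK_right)
open Summit.QuantumFields.BalabanUV.Beta.D1BFx.PackedKernelSplit (blk)
open Summit.QuantumFields.BalabanUV.Beta.D1BFx.StraightPinRestRow (fibreMass_eq_sum_blk)
open Summit.QuantumFields.BalabanUV.Beta.D1BFx.GhostWordFamilies (decay510_tadpoleWord_of_mass)

variable {d : ℕ}

/-! ## §1 `ℓ¹` bookkeeping: the commutator of a diagonal kernel with a kernel of weighted mass -/

/-- [folklore] **THE COMMUTATOR's ENTRIES**: `|[diagK g, V] x z a b| ≤ |V x z a b|·(|g x a| + |g z b|)` (`comp_diagK_left ∕ comp_diagK_right`). -/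
theorem abs_bracket_entry_le (g : Site (d + 1) → Fib d → ℝ) (V : MKer (d + 1) (Fib d)) (x z : Site (d + 1)) (a b : Fib d) :
    |(comp (diagK g) V - comp V (diagK g)) x z a b| ≤ |V x z a b| * (|g x a| + |g z b|) := by
  have e : (comp (diagK g) V - comp V (diagK g)) x z a b = V x z a b * (g x a - g z b) := by
    show comp (diagK g) V x z a b - comp V (diagK g) x z a b = _
    rw [comp_diagK_left, comp_diagK_right]; ring
  rw [e, abs_mul]
  exact mul_le_mul_of_nonneg_left (abs_sub _ _) (abs_nonneg _)

/-- [folklore] **THE TRADE**: if `|g x a| ≤ Gc·e^{−δ|x − p|₁}` (`Gc, δ ≥ 0`) and `V` has σ-WEIGHTED mass `Σ'_{(x,z)} (Σ_{a b} |V x z a b|)·e^{σ(|x − q|₁ + |z − q|₁)} ≤ MV` with `δ ≤ σ`,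
then the commutator `[diagK g, V]` has summable plain mass `≤ 2·Gc·e^{−δ|p − q|₁}·MV` — `e^{−δ|x − p|} ≤ e^{−δ|p − q|}·e^{δ|x − q|}` and the weight absorbs the second factor. -/
theorem wmass_bracket_le {V : MKer (d + 1) (Fib d)} {q : Site (d + 1)} {σ MV : ℝ}
    (hVs : Summable fun pr : Site (d + 1) × Site (d + 1) =>
      (∑ a : Fib d, ∑ b : Fib d, |V pr.1 pr.2 a b|) * Real.exp (σ * (l1 (pr.1 - q) + l1 (pr.2 - q))))
    (hVm : ∑' pr : Site (d + 1) × Site (d + 1),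
      (∑ a : Fib d, ∑ b : Fib d, |V pr.1 pr.2 a b|) * Real.exp (σ * (l1 (pr.1 - q) + l1 (pr.2 - q))) ≤ MV)
    {g : Site (d + 1) → Fib d → ℝ} {Gc δ : ℝ} {p : Site (d + 1)} (hG : 0 ≤ Gc) (hδ : 0 ≤ δ) (hδσ : δ ≤ σ)
    (hg : ∀ x a, |g x a| ≤ Gc * Real.exp (-δ * l1 (x - p))) :
    (Summable fun pr : Site (d + 1) × Site (d + 1) => ∑ a : Fib d, ∑ b : Fib d, |(comp (diagK g) V - comp V (diagK g)) pr.1 pr.2 a b|) ∧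
      ∑' pr : Site (d + 1) × Site (d + 1), ∑ a : Fib d, ∑ b : Fib d, |(comp (diagK g) V - comp V (diagK g)) pr.1 pr.2 a b|
        ≤ 2 * Gc * Real.exp (-δ * l1 (p - q)) * MV := by
  set c : ℝ := 2 * Gc * Real.exp (-δ * l1 (p - q)) with hc
  have hc0 : 0 ≤ c := by positivity
  -- the envelope at a site `y`, traded: `Gc·e^{−δ|y − p|} ≤ Gc·e^{−δ|p − q|}·e^{σ(|x − q| + |z − q|)}` whenever `|y − q| ≤ |x − q| + |z − q|`
  have trade : ∀ x z y : Site (d + 1), l1 (y - q) ≤ l1 (x - q) + l1 (z - q) →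
      Gc * Real.exp (-δ * l1 (y - p)) ≤ Gc * Real.exp (-δ * l1 (p - q)) * Real.exp (σ * (l1 (x - q) + l1 (z - q))) := by
    intro x z y hy
    rw [mul_assoc, ← Real.exp_add]
    refine mul_le_mul_of_nonneg_left (Real.exp_le_exp.2 ?_) hG
    have t : l1 (p - q) ≤ l1 (p - y) + l1 (y - q) := l1_sub_triangle p y q
    rw [l1_sub_symm p y] at t
    have h1 : 0 ≤ l1 (x - q) := l1_nonneg _
    have h2 : 0 ≤ l1 (z - q) := l1_nonneg _
    nlinarith [mul_le_mul_of_nonneg_left hy hδ, mul_le_mul_of_nonneg_right hδσ (add_nonneg h1 h2)]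
  -- pointwise domination of the plain mass of the commutator by `c ×` the weighted mass of `V`
  have hpt : ∀ pr : Site (d + 1) × Site (d + 1),
      (∑ a : Fib d, ∑ b : Fib d, |(comp (diagK g) V - comp V (diagK g)) pr.1 pr.2 a b|)
        ≤ c * ((∑ a : Fib d, ∑ b : Fib d, |V pr.1 pr.2 a b|) * Real.exp (σ * (l1 (pr.1 - q) + l1 (pr.2 - q)))) := by
    rintro ⟨x, z⟩
    dsimp only
    have hx : l1 (x - q) ≤ l1 (x - q) + l1 (z - q) := le_add_of_nonneg_right (l1_nonneg _)
    have hz : l1 (z - q) ≤ l1 (x - q) + l1 (z - q) := le_add_of_nonneg_left (l1_nonneg _)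
    have ex := trade x z x hx
    have ez := trade x z z hz
    have key : ∀ (a b : Fib d), |(comp (diagK g) V - comp V (diagK g)) x z a b| ≤ c * (|V x z a b| * Real.exp (σ * (l1 (x - q) + l1 (z - q)))) := by
      intro a b
      refine (abs_bracket_entry_le g V x z a b).trans ?_
      have hV0 : 0 ≤ |V x z a b| := abs_nonneg _
      calc |V x z a b| * (|g x a| + |g z b|)
          ≤ |V x z a b| * (Gc * Real.exp (-δ * l1 (p - q)) * Real.exp (σ * (l1 (x - q) + l1 (z - q)))
              + Gc * Real.exp (-δ * l1 (p - q)) * Real.exp (σ * (l1 (x - q) + l1 (z - q)))) :=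
            mul_le_mul_of_nonneg_left (add_le_add ((hg x a).trans ex) ((hg z b).trans ez)) hV0
        _ = c * (|V x z a b| * Real.exp (σ * (l1 (x - q) + l1 (z - q)))) := by rw [hc]; ring
    calc ∑ a : Fib d, ∑ b : Fib d, |(comp (diagK g) V - comp V (diagK g)) x z a b|
        ≤ ∑ a : Fib d, ∑ b : Fib d, c * (|V x z a b| * Real.exp (σ * (l1 (x - q) + l1 (z - q)))) :=
          Finset.sum_le_sum fun a _ => Finset.sum_le_sum fun b _ => key a b
      _ = c * ((∑ a : Fib d, ∑ b : Fib d, |V x z a b|) * Real.exp (σ * (l1 (x - q) + l1 (z - q)))) := by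
          rw [Finset.sum_mul, Finset.mul_sum]
          refine Finset.sum_congr rfl fun a _ => ?_
          rw [Finset.sum_mul, Finset.mul_sum]
  have hnn : ∀ pr : Site (d + 1) × Site (d + 1),
      0 ≤ ∑ a : Fib d, ∑ b : Fib d, |(comp (diagK g) V - comp V (diagK g)) pr.1 pr.2 a b| :=
    fun pr => Finset.sum_nonneg fun _ _ => Finset.sum_nonneg fun _ _ => abs_nonneg _
  have hsum : Summable fun pr : Site (d + 1) × Site (d + 1) =>
      ∑ a : Fib d, ∑ b : Fib d, |(comp (diagK g) V - comp V (diagK g)) pr.1 pr.2 a b| :=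
    Summable.of_nonneg_of_le hnn hpt (hVs.mul_left c)
  refine ⟨hsum, ?_⟩
  calc ∑' pr : Site (d + 1) × Site (d + 1), ∑ a : Fib d, ∑ b : Fib d, |(comp (diagK g) V - comp V (diagK g)) pr.1 pr.2 a b|
      ≤ ∑' pr : Site (d + 1) × Site (d + 1),
          c * ((∑ a : Fib d, ∑ b : Fib d, |V pr.1 pr.2 a b|) * Real.exp (σ * (l1 (pr.1 - q) + l1 (pr.2 - q)))) :=
        Summable.tsum_le_tsum hpt hsum (hVs.mul_left c)
    _ = c * ∑' pr : Site (d + 1) × Site (d + 1),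
          (∑ a : Fib d, ∑ b : Fib d, |V pr.1 pr.2 a b|) * Real.exp (σ * (l1 (pr.1 - q) + l1 (pr.2 - q))) := tsum_mul_left
    _ ≤ c * MV := mul_le_mul_of_nonneg_left hVm hc0

/-- [folklore] **PLAIN MASSES ADD**: the plain mass of `A + B` is summable and `≤` the sum of the two bounds. -/
theorem mass_add_le {A B : MKer (d + 1) (Fib d)} {mA mB : ℝ}
    (hA : (Summable fun pr : Site (d + 1) × Site (d + 1) => ∑ a : Fib d, ∑ b : Fib d, |A pr.1 pr.2 a b|) ∧
      ∑' pr : Site (d + 1) × Site (d + 1), ∑ a : Fib d, ∑ b : Fib d, |A pr.1 pr.2 a b| ≤ mA)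
    (hB : (Summable fun pr : Site (d + 1) × Site (d + 1) => ∑ a : Fib d, ∑ b : Fib d, |B pr.1 pr.2 a b|) ∧
      ∑' pr : Site (d + 1) × Site (d + 1), ∑ a : Fib d, ∑ b : Fib d, |B pr.1 pr.2 a b| ≤ mB) :
    (Summable fun pr : Site (d + 1) × Site (d + 1) => ∑ a : Fib d, ∑ b : Fib d, |(A + B) pr.1 pr.2 a b|) ∧
      ∑' pr : Site (d + 1) × Site (d + 1), ∑ a : Fib d, ∑ b : Fib d, |(A + B) pr.1 pr.2 a b| ≤ mA + mB := by
  have hpt : ∀ pr : Site (d + 1) × Site (d + 1),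
      (∑ a : Fib d, ∑ b : Fib d, |(A + B) pr.1 pr.2 a b|)
        ≤ (∑ a : Fib d, ∑ b : Fib d, |A pr.1 pr.2 a b|) + ∑ a : Fib d, ∑ b : Fib d, |B pr.1 pr.2 a b| := by
    intro pr
    rw [← Finset.sum_add_distrib]
    refine Finset.sum_le_sum fun a _ => ?_
    rw [← Finset.sum_add_distrib]
    exact Finset.sum_le_sum fun b _ => abs_add_le _ _
  have hnn : ∀ pr : Site (d + 1) × Site (d + 1), 0 ≤ ∑ a : Fib d, ∑ b : Fib d, |(A + B) pr.1 pr.2 a b| :=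
    fun pr => Finset.sum_nonneg fun _ _ => Finset.sum_nonneg fun _ _ => abs_nonneg _
  have hs : Summable fun pr : Site (d + 1) × Site (d + 1) => ∑ a : Fib d, ∑ b : Fib d, |(A + B) pr.1 pr.2 a b| :=
    Summable.of_nonneg_of_le hnn hpt (hA.1.add hB.1)
  refine ⟨hs, ?_⟩
  calc ∑' pr : Site (d + 1) × Site (d + 1), ∑ a : Fib d, ∑ b : Fib d, |(A + B) pr.1 pr.2 a b|
      ≤ ∑' pr : Site (d + 1) × Site (d + 1),
          ((∑ a : Fib d, ∑ b : Fib d, |A pr.1 pr.2 a b|) + ∑ a : Fib d, ∑ b : Fib d, |B pr.1 pr.2 a b|) :=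
        Summable.tsum_le_tsum hpt hs (hA.1.add hB.1)
    _ = _ := hA.1.tsum_add hB.1
    _ ≤ mA + mB := add_le_add hA.2 hB.2

/-- [folklore] **FOUR WEIGHTED BLOCK MASSES GIVE THE FULL WEIGHTED MASS** (`d = 3`; gan24-leaf-05 g62's `StraightPinRestRow.fibreMass_eq_sum_blk` with a site weight `w ≥ 0` pulled
through; any real weight `w`): block letters `Σ' (Σ_{g f} |blk W j i|·w) ≤ B j i` ⟹ `Σ' (Σ_{g a} |W|)·w ≤ (B tt + B tf) + (B ft + B ff)`. -/
theorem wmass_le_of_blk {W : MKer 4 (Fib 3)} (w : Site 4 × Site 4 → ℝ) {B : Bool → Bool → ℝ}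
    (h : ∀ j i : Bool, (Summable fun q : Site 4 × Site 4 => ∑ g, ∑ f, |blk W j i q.1 q.2 g f| * w q) ∧
      ∑' q : Site 4 × Site 4, ∑ g, ∑ f, |blk W j i q.1 q.2 g f| * w q ≤ B j i) :
    (Summable fun q : Site 4 × Site 4 => (∑ g, ∑ a, |W q.1 q.2 g a|) * w q) ∧
      ∑' q : Site 4 × Site 4, (∑ g, ∑ a, |W q.1 q.2 g a|) * w q ≤ (B true true + B true false) + (B false true + B false false) := by
  have eb : ∀ (j i : Bool) (q : Site 4 × Site 4),
      ∑ g, ∑ f, |blk W j i q.1 q.2 g f| * w q = (∑ g, ∑ f, |blk W j i q.1 q.2 g f|) * w q := by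
    intro j i q
    rw [Finset.sum_mul]
    refine Finset.sum_congr rfl fun g _ => ?_
    rw [Finset.sum_mul]
  have e : (fun q : Site 4 × Site 4 => (∑ g, ∑ a, |W q.1 q.2 g a|) * w q)
      = fun q => ((∑ g, ∑ f, |blk W true true q.1 q.2 g f| * w q) + ∑ g, ∑ f, |blk W true false q.1 q.2 g f| * w q)
        + ((∑ g, ∑ f, |blk W false true q.1 q.2 g f| * w q) + ∑ g, ∑ f, |blk W false false q.1 q.2 g f| * w q) := by
    funext q
    rw [fibreMass_eq_sum_blk W q, eb, eb, eb, eb]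
    ring
  rw [e]
  have htt := h true true
  have htf := h true false
  have hft := h false true
  have hff := h false false
  refine ⟨(htt.1.add htf.1).add (hft.1.add hff.1), ?_⟩
  rw [(htt.1.add htf.1).tsum_add (hft.1.add hff.1), htt.1.tsum_add htf.1, hft.1.tsum_add hff.1]
  exact add_le_add (add_le_add htt.2 htf.2) (add_le_add hft.2 hff.2)

/-! ## §2 The bracket word of a diagonal family against a vertex family is a (5.10)-kernel, any bounded leg -/

/-- [folklore] **`Decay510` OF THE BRACKET WORD FROM A BOUNDED LEG, TWO ENVELOPED DIAGONAL FAMILIES AND TWO VERTEX FAMILIES OF WEIGHTED MASS**: with `Bdd L S` (`0 ≤ S`),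
symbol families `gA`, `gE` obeying `|g_ y x b| ≤ Gc·e^{−δ|x − n•y|₁}` (`Gc, δ ≥ 0`), and kernel families `VA`, `VE` whose σ-weighted masses at `n•y` are `≤ MV` for every `y` (`δ ≤ σ`):
`Decay510 (z ↦ c·tadpole L ([diagK (gE z), VA 0] + [diagK (gA 0), VE z])) (|c|·(S·(2·Gc·MV + 2·Gc·MV))) (n·δ)` — d1-leaf-04's `decay510_tadpoleWord_of_mass` over §1, the two
centres `n•0`, `n•z` at `ℓ¹`-distance `n·|z|₁`. -/
theorem decay510_bracketWord_of_wmass {L : MKer (d + 1) (Fib d)} {S : ℝ} (hL : Bdd L S) (hS : 0 ≤ S) (n : ℕ)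
    {gA gE : Site (d + 1) → Site (d + 1) → Fib d → ℝ} {Gc δ : ℝ} (hG : 0 ≤ Gc) (hδ : 0 ≤ δ)
    (hgA : ∀ y x b, |gA y x b| ≤ Gc * Real.exp (-δ * l1 (x - (n : ℤ) • y)))
    (hgE : ∀ y x b, |gE y x b| ≤ Gc * Real.exp (-δ * l1 (x - (n : ℤ) • y)))
    {VA VE : Site (d + 1) → MKer (d + 1) (Fib d)} {σ MV : ℝ} (hδσ : δ ≤ σ)
    (hVA : ∀ y, (Summable fun pr : Site (d + 1) × Site (d + 1) =>
        (∑ a : Fib d, ∑ b : Fib d, |VA y pr.1 pr.2 a b|) * Real.exp (σ * (l1 (pr.1 - (n : ℤ) • y) + l1 (pr.2 - (n : ℤ) • y)))) ∧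
      ∑' pr : Site (d + 1) × Site (d + 1),
        (∑ a : Fib d, ∑ b : Fib d, |VA y pr.1 pr.2 a b|) * Real.exp (σ * (l1 (pr.1 - (n : ℤ) • y) + l1 (pr.2 - (n : ℤ) • y))) ≤ MV)
    (hVE : ∀ y, (Summable fun pr : Site (d + 1) × Site (d + 1) =>
        (∑ a : Fib d, ∑ b : Fib d, |VE y pr.1 pr.2 a b|) * Real.exp (σ * (l1 (pr.1 - (n : ℤ) • y) + l1 (pr.2 - (n : ℤ) • y)))) ∧
      ∑' pr : Site (d + 1) × Site (d + 1),
        (∑ a : Fib d, ∑ b : Fib d, |VE y pr.1 pr.2 a b|) * Real.exp (σ * (l1 (pr.1 - (n : ℤ) • y) + l1 (pr.2 - (n : ℤ) • y))) ≤ MV)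
    (c : ℝ) :
    Decay510 (fun z : Site (d + 1) => c * tadpole L
        ((comp (diagK (gE z)) (VA 0) - comp (VA 0) (diagK (gE z))) + (comp (diagK (gA 0)) (VE z) - comp (VE z) (diagK (gA 0)))))
      (|c| * (S * (2 * Gc * MV + 2 * Gc * MV))) ((n : ℝ) * δ) := by
  -- the mass letter of the word at every coarse `z`
  have hmass : ∀ z : Site (d + 1),
      (Summable fun pr : Site (d + 1) × Site (d + 1) => ∑ a : Fib d, ∑ b : Fib d,
        |((comp (diagK (gE z)) (VA 0) - comp (VA 0) (diagK (gE z))) + (comp (diagK (gA 0)) (VE z) - comp (VE z) (diagK (gA 0)))) pr.1 pr.2 a b|) ∧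
      ∑' pr : Site (d + 1) × Site (d + 1), ∑ a : Fib d, ∑ b : Fib d,
          |((comp (diagK (gE z)) (VA 0) - comp (VA 0) (diagK (gE z))) + (comp (diagK (gA 0)) (VE z) - comp (VE z) (diagK (gA 0)))) pr.1 pr.2 a b|
        ≤ (2 * Gc * MV + 2 * Gc * MV) * Real.exp (-((n : ℝ) * δ) * l1 z) := by
    intro z
    have h1 := wmass_bracket_le (hVA 0).1 (hVA 0).2 hG hδ hδσ (hgE z)
    have h2 := wmass_bracket_le (hVE z).1 (hVE z).2 hG hδ hδσ (hgA 0)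
    have e1 : l1 ((n : ℤ) • z - (n : ℤ) • (0 : Site (d + 1))) = (n : ℝ) * l1 z := by rw [smul_zero, sub_zero, l1_natSmul]
    have e2 : l1 ((n : ℤ) • (0 : Site (d + 1)) - (n : ℤ) • z) = (n : ℝ) * l1 z := by rw [l1_sub_symm, e1]
    rw [e1] at h1
    rw [e2] at h2
    have h := mass_add_le h1 h2
    refine ⟨h.1, h.2.trans (le_of_eq ?_)⟩
    have e3 : -δ * ((n : ℝ) * l1 z) = -((n : ℝ) * δ) * l1 z := by ring
    rw [e3]; ring
  have hd := decay510_tadpoleWord_of_mass (L := L) (mW := 2 * Gc * MV + 2 * Gc * MV) (κ := (n : ℝ) * δ)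
    (𝒲 := fun (_ : Fin (d + 1)) (y : Site (d + 1)) (_ : Fin (d + 1)) (y' : Site (d + 1)) =>
      (comp (diagK (gE y')) (VA y) - comp (VA y) (diagK (gE y'))) + (comp (diagK (gA y)) (VE y') - comp (VE y') (diagK (gA y))))
    hL hS 0 0 (fun z => (hmass z).1) (fun z => (hmass z).2)
  intro z
  have h := hd z
  rw [abs_mul]
  calc |c| * |tadpole L ((comp (diagK (gE z)) (VA 0) - comp (VA 0) (diagK (gE z))) + (comp (diagK (gA 0)) (VE z) - comp (VE z) (diagK (gA 0))))|
      ≤ |c| * (S * (2 * Gc * MV + 2 * Gc * MV) * Real.exp (-((n : ℝ) * δ) * l1 z)) := mul_le_mul_of_nonneg_left h (abs_nonneg c)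
    _ = _ := by ring

end Summit.QuantumFields.BalabanUV.Beta.D1BFx.DiagBracketWordMass

end
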